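import Summits.QuantumFields.YangMills.Theorems.BalabanUVNodesN21RecentredDilation

/-!
# N21 (NE7c) · ROW P PROVED: radial transversality in the product ∕ partial-dilation frame with ANY density (P1) and
# the RE-CENTRED END about a measurable centre (P2) (lens Card 78 ∕ ROW P, second half)

R134 seat pub-ymgap-dag-n21-d (g8), node N21 = NE7c (single-run shell-weight bound, NOT PRINTED in [Bałaban 1983–89],
NOT proved), lane K3⁷ `SpineGivenEndpointR13SepCoPH` (stmt-QuantumFields-20544, `--kind proof --supports … --as helper`).
Part 28 of the comparison series.  THIS FILE = §E of the lens's `Sketch-nearmiss-g27.lean` (LENS-nearmiss v27.0 ROW P; first refusal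
dag-n21-d) (farm rc 0 · 0 warnings at the lens desk) VERBATIM — statements and proofs — re-homed in this namespace.  AUTHORSHIP OF THE
MATHEMATICS: planner seat `ym-lens-BalabanUVNodes-nearmiss` g27 (memo-only seat, cannot file); this seat only files.  Imports part 27
(§C); cites part 19's `volume_params_le_of_radialTransversal` ∕ `measure_env_le_of_odds` and part 16's `inv_pow_le_three` BY NAME.

WHAT (lens ROW P).  P1 = part 19's ★ `slotAntiConcentration_restrict_of_radialTransversal` in the PRODUCT ∕ PARTIAL-DILATION
frame of part 18 with ANY density (`ι → ℝ`, `l • z`, `e^{−A}`, `card ι` ↦ `X × (κ → ℝ)`, `(p.1, l • p.2)`, `g`,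
`card κ`): `slotAntiConcentration_restrict_of_blockRadialTransversal`; P2 = THE RE-CENTRED END
`slotAntiConcentration_restrict_of_recentredDilation`: `SlotAntiConcentration (ν|({U<θ} ∩ C)) U θ ρ (3(#κ+1)(1+Q)∕(κ₀(1−ρ)))`
with non-collapse, envelope and transversality stated ABOUT A MEASURABLE CENTRE `m z` (P1 for the shear-pulled-back data,
transported by part 27).  §P′ (this seat, lens ROW P′): `slot_field_of_recentredDilation` — the `LevelLedger.slot` inequality on this road.

HONEST FRAMING.  [textbook] measure theory ∕ convexity over the tree's typed (M1) frame (cited by name); every located input stays a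
HYPOTHESIS; 0 def, 0 sorry; nothing of Bałaban's asserted; NE7c NOT PRINTED ∕ NOT proved; N21 NOT discharged; counts
unmoved (typed 28∕28 · discharged 5∕27); count-neutral; one finite 𝕋⁴ at fixed ε — nothing about ℝ⁴ ∕ OS ∕ mass gap ∕ Clay.
-/

open MeasureTheory Set Function Module
open scoped ENNReal
open Literature.MathematicalPhysics.QuantumFieldTheory.Balaban1983to89
open Literature.MathematicalPhysics.QuantumFieldTheory.Balaban1983to89.T4ShellMeasure (SlotAntiConcentration)
open Literature.MathematicalPhysics.QuantumFieldTheory.Balaban1983to89.T4ShellMeasureDet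
  (slotAntiConcentration_withDensity_map)

namespace Summit.QuantumFields.YangMills.Theorems.N21RecentredDilationTransversal

open Summit.QuantumFields.YangMills.Theorems.N21RecentredDilation

/-! ## §E  ROW P, PROVED: part 19 ★ in the product ∕ partial-dilation frame of part 18 with ANY density (P1), and
the RE-CENTRED END about a measurable centre (P2) — offered to dag-n21-d for filing (first refusal) -/

section RowP

variable {X : Type*} [MeasurableSpace X] {κ : Type*} [Fintype κ]

open Summit.QuantumFields.YangMills.Theorems.N21DilationTransversal
  (volume_params_le_of_radialTransversal measure_env_le_of_odds)
open Summit.QuantumFields.YangMills.Theorems.N21DilationHazard (inv_pow_le_three)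

omit [MeasurableSpace X] [Fintype κ] in
/-- **ADMISSIBLE PARAMETERS, FIBREWISE**: part 19's `volume_params_le_of_radialTransversal` on the fibre `{y.1} × ℝ^κ`
— block-radial transversality `U (z, s • w) ≥ U (z, w) + κ₀ a (s − 1)` between points of `T`. [textbook] -/
theorem volume_params_le_of_blockRadialTransversal {U : X × (κ → ℝ) → ℝ} {T : Set (X × (κ → ℝ))}
    {a b κ₀ τ : ℝ} (ha : 0 < a) (hκ : 0 < κ₀) (hτ : τ < 1)
    (hT : ∀ p ∈ T, a ≤ U p ∧ U p < b)
    (hRT : ∀ p ∈ T, ∀ s : ℝ, 1 ≤ s → (p.1, s • p.2) ∈ T → U p + κ₀ * a * (s - 1) ≤ U (p.1, s • p.2))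
    (y : X × (κ → ℝ)) :
    volume {l : ℝ | l ∈ Icc (1 - τ) 1 ∧ (y.1, l⁻¹ • y.2) ∈ T} ≤ ENNReal.ofReal ((b - a) / (κ₀ * a)) :=
  volume_params_le_of_radialTransversal (U := fun w : κ → ℝ => U (y.1, w)) (T := {w : κ → ℝ | (y.1, w) ∈ T})
    ha hκ hτ (fun _ hw => hT _ hw) (fun _ hw s hs hsw => hRT _ hw s hs hsw) y.2

/-- **BLOCK-DILATION AVERAGING WITH A CUT AND AN ENVELOPE, ANY DENSITY** (part 19's
`measure_shellCut_le_average_env` with `ι → ℝ`, `l • z`, `e^{−A}` ↦ `X × (κ → ℝ)`, `(p.1, l • p.2)`, `g`):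
`τ·ν(T) ≤ (1−τ)^{−#κ}·(b−a)/(κ₀a)·ν(Env)` for `ν = (ζ ⊗ vol).withDensity g`, `T = {a ≤ U < b} ∩ C`. [textbook] -/
theorem measure_shellCut_le_average_env_block (ζ : Measure X) [SFinite ζ] {g : X × (κ → ℝ) → ℝ≥0∞}
    (hg : Measurable g) {U : X × (κ → ℝ) → ℝ} (hUm : Measurable U) {C Env : Set (X × (κ → ℝ))}
    (hC : MeasurableSet C) (hEnv : MeasurableSet Env) {a b κ₀ τ : ℝ} (ha : 0 < a) (hκ : 0 < κ₀) (hτ1 : τ < 1)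
    (henv : ∀ l ∈ Icc (1 - τ) 1, ∀ p : X × (κ → ℝ), a ≤ U p → U p < b → p ∈ C → (p.1, l • p.2) ∈ Env)
    (hmono : ∀ l ∈ Icc (1 - τ) 1, ∀ p : X × (κ → ℝ), a ≤ U p → U p < b → p ∈ C → g p ≤ g (p.1, l • p.2))
    (hRT : ∀ p : X × (κ → ℝ), a ≤ U p → U p < b → p ∈ C → ∀ s : ℝ, 1 ≤ s →
      a ≤ U (p.1, s • p.2) → U (p.1, s • p.2) < b → (p.1, s • p.2) ∈ C →
        U p + κ₀ * a * (s - 1) ≤ U (p.1, s • p.2)) :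
    ENNReal.ofReal τ * ((ζ.prod volume).withDensity g) ({p | a ≤ U p ∧ U p < b} ∩ C)
      ≤ ENNReal.ofReal (((1 - τ) ^ Fintype.card κ)⁻¹ * ((b - a) / (κ₀ * a)))
        * ((ζ.prod volume).withDensity g) Env := by
  set T : Set (X × (κ → ℝ)) := {p | a ≤ U p ∧ U p < b} ∩ C with hTdef
  have hT : MeasurableSet T :=
    ((measurableSet_le measurable_const hUm).inter (measurableSet_lt hUm measurable_const)).inter hC
  set d := Fintype.card κ with hd
  rw [withDensity_apply _ hT, withDensity_apply _ hEnv]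
  have hDm' : ∀ l : ℝ, Measurable (fun q : X × (κ → ℝ) => (q.1, l⁻¹ • q.2)) := fun l =>
    measurable_fst.prodMk (measurable_snd.const_smul l⁻¹)
  -- (i) for every l ∈ [1−τ, 1]: ∫_T g ≤ (1−τ)^{-d} ∫ 𝟙[D_l T] g
  have hstep : ∀ l ∈ Icc (1 - τ) 1, ∫⁻ x in T, g x ∂(ζ.prod volume)
      ≤ ENNReal.ofReal (((1 - τ) ^ d)⁻¹) *
          ∫⁻ y, ((fun q : X × (κ → ℝ) => (q.1, l⁻¹ • q.2)) ⁻¹' T).indicator g y ∂(ζ.prod volume) := by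
    intro l hl
    have hl0 : 0 < l := by linarith [hl.1]
    have h := setLIntegral_le_pow_mul_of_blockNonCollapse ζ hg hT hl0
      (fun p hp => hmono l hl p hp.1.1 hp.1.2 hp.2)
    rw [← lintegral_indicator ((hDm' l) hT)] at h
    refine h.trans (mul_le_mul_left (ENNReal.ofReal_le_ofReal ?_) _)
    rw [inv_le_inv₀ (pow_pos hl0 _) (pow_pos (by linarith) _)]
    exact pow_le_pow_left₀ (by linarith) hl.1 _
  -- (ii) integrate over l
  have hI : ENNReal.ofReal τ * ∫⁻ x in T, g x ∂(ζ.prod volume)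
      = ∫⁻ _ in Icc (1 - τ) (1 : ℝ), ∫⁻ x in T, g x ∂(ζ.prod volume) := by
    rw [setLIntegral_const, Real.volume_Icc, mul_comm]
    congr 2
    ring
  rw [hI]
  set F : ℝ × (X × (κ → ℝ)) → ℝ≥0∞ :=
    {q : ℝ × (X × (κ → ℝ)) | (q.2.1, q.1⁻¹ • q.2.2) ∈ T}.indicator (g ∘ Prod.snd) with hFdef
  have hFset : MeasurableSet {q : ℝ × (X × (κ → ℝ)) | (q.2.1, q.1⁻¹ • q.2.2) ∈ T} :=
    ((measurable_fst.comp measurable_snd).prodMk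
      (measurable_fst.inv.smul (measurable_snd.comp measurable_snd))) hT
  have hF : Measurable F := (hg.comp measurable_snd).indicator hFset
  have hFl : ∀ (l : ℝ) (y : X × (κ → ℝ)),
      ((fun q : X × (κ → ℝ) => (q.1, l⁻¹ • q.2)) ⁻¹' T).indicator g y = F (l, y) := by
    intro l y
    by_cases hy : (y.1, l⁻¹ • y.2) ∈ T
    · rw [indicator_of_mem (show y ∈ (fun q : X × (κ → ℝ) => (q.1, l⁻¹ • q.2)) ⁻¹' T from hy), hFdef,
        indicator_of_mem (show (l, y) ∈ {q : ℝ × (X × (κ → ℝ)) | (q.2.1, q.1⁻¹ • q.2.2) ∈ T} from hy)]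
      rfl
    · rw [indicator_of_notMem (show y ∉ (fun q : X × (κ → ℝ) => (q.1, l⁻¹ • q.2)) ⁻¹' T from hy), hFdef,
        indicator_of_notMem (show (l, y) ∉ {q : ℝ × (X × (κ → ℝ)) | (q.2.1, q.1⁻¹ • q.2.2) ∈ T} from hy)]
  have hFunc : Measurable (Function.uncurry fun (l : ℝ) (y : X × (κ → ℝ)) => F (l, y)) := hF
  calc ∫⁻ l in Icc (1 - τ) (1 : ℝ), ∫⁻ x in T, g x ∂(ζ.prod volume)
      ≤ ∫⁻ l in Icc (1 - τ) (1 : ℝ), ENNReal.ofReal (((1 - τ) ^ d)⁻¹) * ∫⁻ y, F (l, y) ∂(ζ.prod volume) := by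
        refine setLIntegral_mono' measurableSet_Icc fun l hl => ?_
        have := hstep l hl
        simp_rw [hFl l] at this
        exact this
    _ = ENNReal.ofReal (((1 - τ) ^ d)⁻¹) *
          ∫⁻ l in Icc (1 - τ) (1 : ℝ), ∫⁻ y, F (l, y) ∂(ζ.prod volume) := by
        rw [lintegral_const_mul' _ _ ENNReal.ofReal_ne_top]
    _ = ENNReal.ofReal (((1 - τ) ^ d)⁻¹) *
          ∫⁻ y, (∫⁻ l in Icc (1 - τ) (1 : ℝ), F (l, y)) ∂(ζ.prod volume) := by
        rw [lintegral_lintegral_swap hFunc.aemeasurable]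
    _ ≤ ENNReal.ofReal (((1 - τ) ^ d)⁻¹) *
          ∫⁻ y, ENNReal.ofReal ((b - a) / (κ₀ * a)) * Env.indicator g y ∂(ζ.prod volume) := by
        refine mul_le_mul_right (lintegral_mono fun y => ?_) _
        have hind : ∀ l, F (l, y) = {l : ℝ | (y.1, l⁻¹ • y.2) ∈ T}.indicator (fun _ => g y) l := by
          intro l
          by_cases h : (y.1, l⁻¹ • y.2) ∈ T
          · rw [hFdef, indicator_of_mem
                (show (l, y) ∈ {q : ℝ × (X × (κ → ℝ)) | (q.2.1, q.1⁻¹ • q.2.2) ∈ T} from h),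
              indicator_of_mem (show l ∈ {l : ℝ | (y.1, l⁻¹ • y.2) ∈ T} from h)]
            rfl
          · rw [hFdef, indicator_of_notMem
                (show (l, y) ∉ {q : ℝ × (X × (κ → ℝ)) | (q.2.1, q.1⁻¹ • q.2.2) ∈ T} from h),
              indicator_of_notMem (show l ∉ {l : ℝ | (y.1, l⁻¹ • y.2) ∈ T} from h)]
        have hlset : MeasurableSet {l : ℝ | (y.1, l⁻¹ • y.2) ∈ T} :=
          (measurable_const.prodMk (measurable_inv.smul_const y.2)) hT
        simp_rw [hind]
        rw [lintegral_indicator hlset, setLIntegral_const, Measure.restrict_apply hlset]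
        have hset_eq : {l : ℝ | (y.1, l⁻¹ • y.2) ∈ T} ∩ Icc (1 - τ) 1
            = {l : ℝ | l ∈ Icc (1 - τ) 1 ∧ (y.1, l⁻¹ • y.2) ∈ T} := by
          ext l; simp only [mem_inter_iff, mem_setOf_eq]; tauto
        rw [hset_eq, mul_comm]
        by_cases hyE : y ∈ Env
        · rw [indicator_of_mem hyE]
          refine mul_le_mul_left ?_ _
          refine volume_params_le_of_blockRadialTransversal (T := T) ha hκ hτ1 (fun z hz => hz.1) ?_ y
          intro z hz s hs hsz
          exact hRT z hz.1.1 hz.1.2 hz.2 s hs hsz.1.1 hsz.1.2 hsz.2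
        · -- no admissible parameter: `(y.1, l⁻¹ • y.2) ∈ T` would put `y` in `Env`
          have hempty : {l : ℝ | l ∈ Icc (1 - τ) 1 ∧ (y.1, l⁻¹ • y.2) ∈ T} = ∅ := by
            ext l
            simp only [mem_setOf_eq, mem_empty_iff_false, iff_false, not_and]
            intro hl hly
            apply hyE
            have hl0 : l ≠ 0 := by linarith [hl.1]
            have := henv l hl (y.1, l⁻¹ • y.2) hly.1.1 hly.1.2 hly.2
            simpa only [smul_inv_smul₀ hl0, Prod.mk.eta] using this
          rw [hempty, measure_empty, zero_mul]
          exact bot_le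
    _ = ENNReal.ofReal (((1 - τ) ^ d)⁻¹ * ((b - a) / (κ₀ * a))) * ∫⁻ y in Env, g y ∂(ζ.prod volume) := by
        rw [lintegral_const_mul _ (hg.indicator hEnv), lintegral_indicator hEnv, ← mul_assoc,
          ← ENNReal.ofReal_mul (inv_nonneg.2 (pow_nonneg (by linarith) _))]

/-- **THE SHELL ∩ CUT IS A `3(#κ+1)ρ∕(κ₀(1−ρ))`-FRACTION OF THE ENVELOPE MASS** (`τ = 1∕(#κ+1)`). [textbook] -/
theorem measure_shellCut_le_of_blockRadialTransversal [Nonempty κ] (ζ : Measure X) [SFinite ζ]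
    {g : X × (κ → ℝ) → ℝ≥0∞} (hg : Measurable g) {U : X × (κ → ℝ) → ℝ} (hUm : Measurable U)
    {C Env : Set (X × (κ → ℝ))} (hC : MeasurableSet C) (hEnv : MeasurableSet Env) {θ ρ κ₀ : ℝ}
    (hθ : 0 < θ) (hρ0 : 0 < ρ) (hρ1 : ρ < 1) (hκ : 0 < κ₀)
    (henv : ∀ l ∈ Icc (1 - 1 / ((Fintype.card κ : ℝ) + 1)) 1, ∀ p : X × (κ → ℝ),
      θ * (1 - ρ) ≤ U p → U p < θ → p ∈ C → (p.1, l • p.2) ∈ Env)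
    (hmono : ∀ l ∈ Icc (1 - 1 / ((Fintype.card κ : ℝ) + 1)) 1, ∀ p : X × (κ → ℝ),
      θ * (1 - ρ) ≤ U p → U p < θ → p ∈ C → g p ≤ g (p.1, l • p.2))
    (hRT : ∀ p : X × (κ → ℝ), θ * (1 - ρ) ≤ U p → U p < θ → p ∈ C → ∀ s : ℝ, 1 ≤ s →
      θ * (1 - ρ) ≤ U (p.1, s • p.2) → U (p.1, s • p.2) < θ → (p.1, s • p.2) ∈ C →
        U p + κ₀ * (θ * (1 - ρ)) * (s - 1) ≤ U (p.1, s • p.2)) :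
    ((ζ.prod volume).withDensity g) ({p | θ * (1 - ρ) ≤ U p ∧ U p < θ} ∩ C)
      ≤ ENNReal.ofReal (3 * ((Fintype.card κ : ℝ) + 1) * (ρ / (κ₀ * (1 - ρ))))
        * ((ζ.prod volume).withDensity g) Env := by
  set d := Fintype.card κ with hd
  set τ : ℝ := 1 / ((d : ℝ) + 1) with hτ
  have hd1 : (0 : ℝ) < d + 1 := by positivity
  have hdge : (1 : ℝ) ≤ d := by
    rw [hd]
    exact_mod_cast Fintype.card_pos
  have hτ0 : 0 < τ := by positivity
  have hτ1 : τ < 1 := by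
    rw [hτ, div_lt_one hd1]
    linarith
  have ha : 0 < θ * (1 - ρ) := mul_pos hθ (by linarith)
  have h := measure_shellCut_le_average_env_block ζ hg hUm hC hEnv ha hκ hτ1 henv hmono hRT
  have hτne : ENNReal.ofReal τ ≠ 0 := (ENNReal.ofReal_pos.2 hτ0).ne'
  have hτtop : ENNReal.ofReal τ ≠ ⊤ := ENNReal.ofReal_ne_top
  have hkey : ((ζ.prod volume).withDensity g) ({p | θ * (1 - ρ) ≤ U p ∧ U p < θ} ∩ C)
      ≤ (ENNReal.ofReal τ)⁻¹ * (ENNReal.ofReal (((1 - τ) ^ d)⁻¹ * ((θ - θ * (1 - ρ)) / (κ₀ * (θ * (1 - ρ)))))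
        * ((ζ.prod volume).withDensity g) Env) := by
    rw [← ENNReal.mul_le_iff_le_inv hτne hτtop]
    exact h
  refine hkey.trans ?_
  rw [← mul_assoc, ← ENNReal.ofReal_inv_of_pos hτ0, ← ENNReal.ofReal_mul (inv_nonneg.2 hτ0.le)]
  refine mul_le_mul' (ENNReal.ofReal_le_ofReal ?_) le_rfl
  have hfrac : (θ - θ * (1 - ρ)) / (κ₀ * (θ * (1 - ρ))) = ρ / (κ₀ * (1 - ρ)) := by
    field_simp
    ring
  have hinv : τ⁻¹ = (d : ℝ) + 1 := by rw [hτ, one_div, inv_inv]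
  rw [hfrac, hinv]
  have h3 := inv_pow_le_three d
  have hρ' : 0 ≤ ρ / (κ₀ * (1 - ρ)) := div_nonneg hρ0.le (mul_nonneg hκ.le (by linarith))
  calc ((d : ℝ) + 1) * (((1 - τ) ^ d)⁻¹ * (ρ / (κ₀ * (1 - ρ))))
      ≤ ((d : ℝ) + 1) * (3 * (ρ / (κ₀ * (1 - ρ)))) := by
        refine mul_le_mul_of_nonneg_left (mul_le_mul_of_nonneg_right ?_ hρ') hd1.le
        rw [hτ]; exact h3
    _ = 3 * ((d : ℝ) + 1) * (ρ / (κ₀ * (1 - ρ))) := by ring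

/-- **P1.  (M1) ON THE CUT LAW UNDER BLOCK-RADIAL TRANSVERSALITY, ANY DENSITY, DROPPED CUTS CHARGED TO ODDS** — part
19 ★ ⊗ part 18: `SlotAntiConcentration (ν|({U<θ} ∩ C)) U θ ρ (3(#κ+1)(1+Q)∕(κ₀(1−ρ)))` for
`ν = (ζ ⊗ vol).withDensity g` on `X × (κ → ℝ)`, block dilation `(z, w) ↦ (z, l • w)` at fixed centre `0`. [textbook] -/
theorem slotAntiConcentration_restrict_of_blockRadialTransversal [Nonempty κ] (ζ : Measure X) [SFinite ζ]
    {g : X × (κ → ℝ) → ℝ≥0∞} (hg : Measurable g) {U : X × (κ → ℝ) → ℝ} (hUm : Measurable U)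
    {C Env : Set (X × (κ → ℝ))} (hC : MeasurableSet C) (hEnv : MeasurableSet Env)
    {θ ρ κ₀ Q : ℝ} (hθ : 0 < θ) (hρ0 : 0 < ρ) (hρ1 : ρ < 1) (hκ : 0 < κ₀) (hQ0 : 0 ≤ Q)
    (henv : ∀ l ∈ Icc (1 - 1 / ((Fintype.card κ : ℝ) + 1)) 1, ∀ p : X × (κ → ℝ),
      θ * (1 - ρ) ≤ U p → U p < θ → p ∈ C → (p.1, l • p.2) ∈ Env)
    (hmono : ∀ l ∈ Icc (1 - 1 / ((Fintype.card κ : ℝ) + 1)) 1, ∀ p : X × (κ → ℝ),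
      θ * (1 - ρ) ≤ U p → U p < θ → p ∈ C → g p ≤ g (p.1, l • p.2))
    (hRT : ∀ p : X × (κ → ℝ), θ * (1 - ρ) ≤ U p → U p < θ → p ∈ C → ∀ s : ℝ, 1 ≤ s →
      θ * (1 - ρ) ≤ U (p.1, s • p.2) → U (p.1, s • p.2) < θ → (p.1, s • p.2) ∈ C →
        U p + κ₀ * (θ * (1 - ρ)) * (s - 1) ≤ U (p.1, s • p.2))
    (hQ : ((ζ.prod volume).withDensity g) (Env \ ({p | U p < θ} ∩ C))
      ≤ ENNReal.ofReal Q * ((ζ.prod volume).withDensity g) ({p | U p < θ} ∩ C)) :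
    SlotAntiConcentration (((ζ.prod volume).withDensity g).restrict ({p | U p < θ} ∩ C)) U θ ρ
      (3 * ((Fintype.card κ : ℝ) + 1) * (1 + Q) / (κ₀ * (1 - ρ))) := by
  unfold SlotAntiConcentration
  have hE : MeasurableSet ({x : X × (κ → ℝ) | U x < θ} ∩ C) := (measurableSet_lt hUm measurable_const).inter hC
  have hinter : {x : X × (κ → ℝ) | θ * (1 - ρ) ≤ U x ∧ U x < θ} ∩ ({x | U x < θ} ∩ C)
      = {x | θ * (1 - ρ) ≤ U x ∧ U x < θ} ∩ C := by
    ext x; simp only [mem_inter_iff, mem_setOf_eq]; tauto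
  rw [Measure.restrict_apply_univ, Measure.restrict_apply' hE, hinter]
  have h1 := measure_shellCut_le_of_blockRadialTransversal ζ hg hUm hC hEnv hθ hρ0 hρ1 hκ henv hmono hRT
  have h2 := measure_env_le_of_odds ((ζ.prod volume).withDensity g) _ _ hQ0 hQ
  refine h1.trans ((mul_le_mul_right h2 _).trans (le_of_eq ?_))
  rw [← mul_assoc, ← ENNReal.ofReal_mul (by positivity [show (0:ℝ) < 1 - ρ by linarith])]
  congr 2
  field_simp

/-- **P2.  THE RE-CENTRED END**: the same conclusion when the block dilation is taken ABOUT A MEASURABLE CENTRE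
`m z` depending on the exterior point, `R_l (z, w) = (z, m z + l • (w − m z))` — non-collapse of the density, the
envelope and transversality all stated about the centre.  Proof: P1 for the shear-pulled-back data (§C), transported
back by `slotAC_restrict_of_recentred`.  THIS is the statement the convex-potential ∕ pinned-minimiser inputs of §B
and the offset bound of §D instantiate. [textbook] -/
theorem slotAntiConcentration_restrict_of_recentredDilation [Nonempty κ] (ζ : Measure X) [SFinite ζ]
    {m : X → (κ → ℝ)} (hm : Measurable m)
    {g : X × (κ → ℝ) → ℝ≥0∞} (hg : Measurable g) {U : X × (κ → ℝ) → ℝ} (hUm : Measurable U)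
    {C Env : Set (X × (κ → ℝ))} (hC : MeasurableSet C) (hEnv : MeasurableSet Env)
    {θ ρ κ₀ Q : ℝ} (hθ : 0 < θ) (hρ0 : 0 < ρ) (hρ1 : ρ < 1) (hκ : 0 < κ₀) (hQ0 : 0 ≤ Q)
    (henv : ∀ l ∈ Icc (1 - 1 / ((Fintype.card κ : ℝ) + 1)) 1, ∀ p : X × (κ → ℝ),
      θ * (1 - ρ) ≤ U p → U p < θ → p ∈ C → (p.1, m p.1 + l • (p.2 - m p.1)) ∈ Env)
    (hmono : ∀ l ∈ Icc (1 - 1 / ((Fintype.card κ : ℝ) + 1)) 1, ∀ p : X × (κ → ℝ),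
      θ * (1 - ρ) ≤ U p → U p < θ → p ∈ C → g p ≤ g (p.1, m p.1 + l • (p.2 - m p.1)))
    (hRT : ∀ p : X × (κ → ℝ), θ * (1 - ρ) ≤ U p → U p < θ → p ∈ C → ∀ s : ℝ, 1 ≤ s →
      θ * (1 - ρ) ≤ U (p.1, m p.1 + s • (p.2 - m p.1)) → U (p.1, m p.1 + s • (p.2 - m p.1)) < θ →
        (p.1, m p.1 + s • (p.2 - m p.1)) ∈ C →
          U p + κ₀ * (θ * (1 - ρ)) * (s - 1) ≤ U (p.1, m p.1 + s • (p.2 - m p.1)))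
    (hQ : ((ζ.prod volume).withDensity g) (Env \ ({p | U p < θ} ∩ C))
      ≤ ENNReal.ofReal Q * ((ζ.prod volume).withDensity g) ({p | U p < θ} ∩ C)) :
    SlotAntiConcentration (((ζ.prod volume).withDensity g).restrict ({p | U p < θ} ∩ C)) U θ ρ
      (3 * ((Fintype.card κ : ℝ) + 1) * (1 + Q) / (κ₀ * (1 - ρ))) := by
  -- the shear to centred coordinates and the pulled-back data
  set e : X × (κ → ℝ) → X × (κ → ℝ) := fun p => (p.1, m p.1 + p.2) with hedef
  have he : MeasurePreserving e (ζ.prod volume) (ζ.prod volume) := measurePreserving_shearRecentre ζ hm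
  have hR : ∀ (s : ℝ) (q : X × (κ → ℝ)),
      ((e q).1, m (e q).1 + s • ((e q).2 - m (e q).1)) = e (q.1, s • q.2) := by
    intro s q
    simp only [hedef, add_sub_cancel_left]
  have hge : Measurable (g ∘ e) := hg.comp he.measurable
  have hUe : Measurable (U ∘ e) := hUm.comp he.measurable
  have hCe : MeasurableSet (e ⁻¹' C) := he.measurable hC
  have hEnve : MeasurableSet (e ⁻¹' Env) := he.measurable hEnv
  -- the four hypotheses, read in centred coordinates (dilation about the centre = block dilation about 0)
  have henv' : ∀ l ∈ Icc (1 - 1 / ((Fintype.card κ : ℝ) + 1)) 1, ∀ q : X × (κ → ℝ),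
      θ * (1 - ρ) ≤ (U ∘ e) q → (U ∘ e) q < θ → q ∈ e ⁻¹' C → (q.1, l • q.2) ∈ e ⁻¹' Env := by
    intro l hl q h1 h2 h3
    have := henv l hl (e q) h1 h2 h3
    rw [hR l q] at this
    exact this
  have hmono' : ∀ l ∈ Icc (1 - 1 / ((Fintype.card κ : ℝ) + 1)) 1, ∀ q : X × (κ → ℝ),
      θ * (1 - ρ) ≤ (U ∘ e) q → (U ∘ e) q < θ → q ∈ e ⁻¹' C → (g ∘ e) q ≤ (g ∘ e) (q.1, l • q.2) := by
    intro l hl q h1 h2 h3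
    have := hmono l hl (e q) h1 h2 h3
    rw [hR l q] at this
    exact this
  have hRT' : ∀ q : X × (κ → ℝ), θ * (1 - ρ) ≤ (U ∘ e) q → (U ∘ e) q < θ → q ∈ e ⁻¹' C → ∀ s : ℝ, 1 ≤ s →
      θ * (1 - ρ) ≤ (U ∘ e) (q.1, s • q.2) → (U ∘ e) (q.1, s • q.2) < θ → (q.1, s • q.2) ∈ e ⁻¹' C →
        (U ∘ e) q + κ₀ * (θ * (1 - ρ)) * (s - 1) ≤ (U ∘ e) (q.1, s • q.2) := by
    intro q h1 h2 h3 s hs h4 h5 h6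
    have key := hRT (e q) h1 h2 h3 s hs
    rw [hR s q] at key
    exact key h4 h5 h6
  -- the law of the pulled-back data pushes forward to `ν`
  have hmapν : ((ζ.prod volume).withDensity (g ∘ e)).map e = (ζ.prod volume).withDensity g := by
    rw [← T4ShellMeasureDet.withDensity_map_eq_map_withDensity_comp he.measurable hg, he.map_eq]
  have hB : MeasurableSet ({p : X × (κ → ℝ) | U p < θ} ∩ C) := (measurableSet_lt hUm measurable_const).inter hC
  have hA : MeasurableSet (Env \ ({p : X × (κ → ℝ) | U p < θ} ∩ C)) := hEnv.diff hB
  have hQ' : ((ζ.prod volume).withDensity (g ∘ e)) (e ⁻¹' Env \ ({q | (U ∘ e) q < θ} ∩ e ⁻¹' C))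
      ≤ ENNReal.ofReal Q * ((ζ.prod volume).withDensity (g ∘ e)) ({q | (U ∘ e) q < θ} ∩ e ⁻¹' C) := by
    have h1 := hQ
    rw [← hmapν, Measure.map_apply he.measurable hA, Measure.map_apply he.measurable hB] at h1
    exact h1
  -- P1 in centred coordinates, transported back through the shear
  have hP1 := slotAntiConcentration_restrict_of_blockRadialTransversal ζ hge hUe hCe hEnve hθ hρ0 hρ1 hκ hQ0
    henv' hmono' hRT' hQ'
  exact slotAC_restrict_of_recentred ζ hm hg hUm hB hP1

end RowP

/-! ## §P′ (this seat, lens ROW P′) The `LevelLedger.slot` field on the re-centred road -/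

open Literature.MathematicalPhysics.QuantumFieldTheory.Balaban1983to89.T4ShellMeasure (slot_field_of_antiConcentration) in
/-- **THE SLOT FIELD ON THE RE-CENTRED ROAD** (lens ROW P′): P2 composed with
`T4ShellMeasure.slot_field_of_antiConcentration` — with the dictionary binders (pieces `≤ M₀ ×` shell mass of the cut law
`μ = ν|({U<θ} ∩ C)`, `M₀ · μ(univ) ≤ Σ A`, `μ` finite): `Σ piece ≤ (3(#κ+1)(1+Q)∕(κ₀(1−ρ)) · ρ) · Σ A` — the
level-constant shape `((1+Q)∕κ₀)·3(d+1)∕(1−ρ)` of part 19 §E ∕ part 26. [folklore] -/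
theorem slot_field_of_recentredDilation {X : Type*} [MeasurableSpace X] {κ : Type*} [Fintype κ] [Nonempty κ]
    (ζ : Measure X) [SFinite ζ]
    {m : X → (κ → ℝ)} (hm : Measurable m)
    {g : X × (κ → ℝ) → ℝ≥0∞} (hg : Measurable g) [IsFiniteMeasure ((ζ.prod volume).withDensity g)]
    {U : X × (κ → ℝ) → ℝ} (hUm : Measurable U)
    {C Env : Set (X × (κ → ℝ))} (hC : MeasurableSet C) (hEnv : MeasurableSet Env)
    {θ ρ κ₀ Q : ℝ} (hθ : 0 < θ) (hρ0 : 0 < ρ) (hρ1 : ρ < 1) (hκ : 0 < κ₀) (hQ0 : 0 ≤ Q)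
    (henv : ∀ l ∈ Icc (1 - 1 / ((Fintype.card κ : ℝ) + 1)) 1, ∀ p : X × (κ → ℝ),
      θ * (1 - ρ) ≤ U p → U p < θ → p ∈ C → (p.1, m p.1 + l • (p.2 - m p.1)) ∈ Env)
    (hmono : ∀ l ∈ Icc (1 - 1 / ((Fintype.card κ : ℝ) + 1)) 1, ∀ p : X × (κ → ℝ),
      θ * (1 - ρ) ≤ U p → U p < θ → p ∈ C → g p ≤ g (p.1, m p.1 + l • (p.2 - m p.1)))
    (hRT : ∀ p : X × (κ → ℝ), θ * (1 - ρ) ≤ U p → U p < θ → p ∈ C → ∀ s : ℝ, 1 ≤ s →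
      θ * (1 - ρ) ≤ U (p.1, m p.1 + s • (p.2 - m p.1)) → U (p.1, m p.1 + s • (p.2 - m p.1)) < θ →
        (p.1, m p.1 + s • (p.2 - m p.1)) ∈ C →
          U p + κ₀ * (θ * (1 - ρ)) * (s - 1) ≤ U (p.1, m p.1 + s • (p.2 - m p.1)))
    (hQ : ((ζ.prod volume).withDensity g) (Env \ ({p | U p < θ} ∩ C))
      ≤ ENNReal.ofReal Q * ((ζ.prod volume).withDensity g) ({p | U p < θ} ∩ C))
    {τ : Type*} (T : Finset τ) {piece Aw : τ → ℝ} {M₀ : ℝ} (hM₀ : 0 ≤ M₀)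
    (hpiece : ∑ t ∈ T, piece t ≤ M₀ *
      ((((ζ.prod volume).withDensity g).restrict ({p | U p < θ} ∩ C)) {p | θ * (1 - ρ) ≤ U p ∧ U p < θ}).toReal)
    (hAw : M₀ * ((((ζ.prod volume).withDensity g).restrict ({p | U p < θ} ∩ C)) univ).toReal ≤ ∑ t ∈ T, Aw t) :
    ∑ t ∈ T, piece t
      ≤ (3 * ((Fintype.card κ : ℝ) + 1) * (1 + Q) / (κ₀ * (1 - ρ)) * ρ) * ∑ t ∈ T, Aw t := by
  have h := slotAntiConcentration_restrict_of_recentredDilation ζ hm hg hUm hC hEnv hθ hρ0 hρ1 hκ hQ0 henv hmono hRT hQ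
  have hD : 0 ≤ 3 * ((Fintype.card κ : ℝ) + 1) * (1 + Q) / (κ₀ * (1 - ρ)) := by
    have : (0 : ℝ) < 1 - ρ := by linarith
    positivity
  exact slot_field_of_antiConcentration hD hρ0.le h T hM₀ hpiece hAw

end Summit.QuantumFields.YangMills.Theorems.N21RecentredDilationTransversal
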